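/-
Copyright (c) 2026 the pub-hodgecm-mathlib formalisation cell (harness21).  Prover seat hodgecm-mathlib-LH4-p06 (g9), req620 Track A «(D-RAM) FOUR-FRAME» squad
F0∕P3c∕LH4; the (β₂) road (R-36) «PURE-CELL LEDGER», β₂-BOARD v2 row (ROW), β₂ WORD #21 (e) of the sub-dealer LH4-p04 (g9): piece (ROW-REL-S2d) «THE SPECIAL CELL AT
δ = 2d IS THE TWIST OF THE DIAGONAL CELL»; helper lane on h413 = stmt-HodgeConjecture-24833 (count-neutral).  2026-09-05.
-/
import Summits.HodgeConjecture.HodgeConjecture.Theorems.F0P3cDyRamRowPureCellOfBit        -- ★ p863357 (this seat): the FOLD `cellDiff_eq_sign_mul_of_bit`; brings ★ p863274 `exists_row_fixed_unit`, ★ p863209 MASTER, ★ p862848, the ‹OFF› vocabulary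
import Summits.HodgeConjecture.HodgeConjecture.Theorems.F0P3cDyRamDiagonalCellPopRead      -- ★ p863319 (LH4-p19 (g2), K7b): `isNorm_iff_isNorm_mul_iff` (the index-two dichotomy)
import Literature.NumberTheory.LocalFields.WildQuadraticDatumNormSignConductor              -- ★ `exists_fixed_unit_not_norm_v_sub_one_le` (a `σ`-fixed non-norm unit, `|2| < 1`)
import HarnessLib

/-!
# Crux `H413`, line LH4 «(D-RAM) FOUR-FRAME» — STAGE-1b, row (2), the (β₂) road (R-36), lane B, β₂ WORD #21 (e): (ROW-REL-S2d) «THE SPECIAL CELL `j = b + (2d − 2)` AT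
# `jl = m + 2d`, `d = 2`, IS MINUS THE DIAGONAL CELL»: `n(b,b) * (X(j,b)) = -(n(j,b) * (X(b,b)))` — at `q = 2` UNCONDITIONALLY, at `q ≥ 4` modulo the per-vertex socket ‹SDIG›

Cell `hodgecm-mathlib` (D-0151), FLOOR 0, crux item H413 = `stmt-HodgeConjecture-24833`, route of record `HCCMUnconditional`; squad F0∕P3c∕LH4; lane
`--supports stmt-HodgeConjecture-24833 --as helper` (count-neutral; pays NO tier-0 row).  THEOREMS ONLY (no `def`, no instance, no notation, no `sorry`, default heartbeats);
★-only imports; states NO law; (β₂) stays a HYPOTHESIS.  Binders: a SUBSET of the β₂ sub-dealer's one-literal general block (‹OFF.letter.v1› c339e0c43a275fb0 = ‹S2D.letter.v1›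
15d4b1744f298901 lines 2–43) by name and byte; `X(j,b)` = its two-finsum difference VERBATIM, `n(j,b)` the unlabelled weighted size; the conclusion of §2∕§4 is ‹S2D›'s lines 45–82 VERBATIM.
WHY.  On the row `2b = m` with `d = 2` (`m* = 3`) and `jl = m + 2d = 2b + 4`, the cell `j = b + 2` satisfies `jl = j + b + 2(d − 1) + d % 2` — it is EXACTLY the FLIP DIGIT of ★ p862848 §3
`valueSet_rowVertex_eq_twist_smul_xPlus_of_tokens` (one digit short of the clean scale `j + b + m* ≤ jl` of the MASTER ★ p863209).  So, at `q = 2`, every glued vertex over the cell reads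
`VS_{m*} = valueSetMod σ ϖ m* ((c·fE·h_W·N(ϖ^b g₀1)) • X₊)` for a `σ`-fixed NON-norm unit `c`, with the SAME row unit `fE` of ★ `exists_row_fixed_unit` that the MASTER uses on
the diagonal cell `(b,b)` (precision `2b + m*`; no extra digit of `u₀₀`, no extra fence): the special cell's bit is the OPPOSITE of the diagonal bit (index two), the FOLD ★ p863357
makes the cell pure with that bit, and `n(b,b)·X(j,b) = −n(j,b)·X(b,b)`.  At `q ≥ 4` the per-vertex opposite-bit statement is the socket ‹SDIG› (typed exactly like ‹BDIG› of
★ p863357 with `↔ ¬ ∃ z, z·σz = fE·h_W`; LH4-p16's K6 digit-line road pays it); the hypothesis `¬ ∃ iso` of ‹S2D› is not consumed at `q = 2`.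
* §1 `valueSet_SVertex_eq_xPlus_iff_not` — the bit of ONE glued vertex over the special cell (`q = 2`): `VS_{m*}(L) = valueSetMod σ ϖ m* X₊ ↔ ¬ (fE·h_W ∈ N(E^×))`.
* §2 `n_diag_mul_cellDiff_S_eq_neg_of_sdig` — (ROW-REL-S2d) at `d = 2` MODULO ‹SDIG› (all `q`): ★ MASTER at `j = b`, ★ FOLD at `β := ¬ (fE·h_W ∈ N)`.
* §3 `sdig_of_card_two` — ‹SDIG› at `#𝓀[E] = 2` (§1 on ★ p862869's presentation of every glued vertex); `n_diag_mul_cellDiff_S_eq_neg_of_card_two` — (ROW-REL-S2d) at `d = 2`, `q = 2`.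
HONEST LABEL.  Count-neutral lattice bookkeeping; nothing printed is asserted; ‹SDIG› at q ≥ 4 is an OPEN hypothesis; `HC_CM` is proved only modulo the 7 printed citations
(2 remaining named inputs: hLiu418 = `stmt-HodgeConjecture-24832`, h413 = `stmt-HodgeConjecture-24833`) until rung 0 closes.  References: [Kottwitz1986BaseChangeUnits] §1
pp. 240–241; [Rogawski1990] §4.9 Prop. 4.9.1 (b) p. 55; [Serre1979] Ch. III §6 Prop. 12, Ch. V §3 Prop. 5, Cor. 2–3; [Jacobowitz1962] §4; [LabesseLanglands1979] §2 p. 8.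
-/

set_option autoImplicit false

noncomputable section
namespace Summit.HodgeConjecture.HodgeConjecture.Cruxes.H413.F0P3cDyRamRowSCellTwist

open scoped Valued WithZero Matrix MatrixGroups Classical
open WithZero
open Literature.NumberTheory.Automorphic Literature.NumberTheory.Automorphic.HermitianLattice Literature.NumberTheory.Automorphic.UnitaryLatticeTree
open Literature.NumberTheory.Automorphic.UnitaryThreeFourFrame (IsRamifiedQuadraticDatum)
open Literature.NumberTheory.Rogawski1990
open Literature.NumberTheory.LocalFields (isAdicComplete_valuedInteger_of_completeSpace)
open Summit.HodgeConjecture.HodgeConjecture.Cruxes.H413.F0P3cDyRamFourFramePieces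
open Summit.HodgeConjecture.HodgeConjecture.Cruxes.H413.F0P3cDyRamFourFrameCensusDefs (LatticeInLevel LatticeNearTransvShell)
open Summit.HodgeConjecture.HodgeConjecture.Cruxes.H413.F0P3cDyRamStageOneBDefs (mcOfRecord)
open Summit.HodgeConjecture.HodgeConjecture.Cruxes.H413.F0P3cDyRamToricCensusDefs
open Summit.HodgeConjecture.HodgeConjecture.Cruxes.H413.F0P3cDyRamRowCellOnShell (uniformizer_letters latticeNearTransvShell_zero_of_row)
open Summit.HodgeConjecture.HodgeConjecture.Cruxes.H413.F0P3cDyRamConeCellPresentation (exists_presentation_of_mem_levelSetDep)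
open Summit.HodgeConjecture.HodgeConjecture.Cruxes.H413.F0P3cDyRamRowVertexLettersOfTokens (valueSet_rowVertex_eq_smul_xPlus_of_tokens)
open Summit.HodgeConjecture.HodgeConjecture.Cruxes.H413.F0P3cDyRamRowVertexLettersOfTokens (valueSet_rowVertex_eq_twist_smul_xPlus_of_tokens)
open Summit.HodgeConjecture.HodgeConjecture.Cruxes.H413.F0P3cDyRamDiagonalCellCleanRegime (v_map_le_pow_iff v_eq_pow_of_map_eq)
open Summit.HodgeConjecture.HodgeConjecture.Cruxes.H413.F0P3cDyRamSmulXPlusLabel (labelPlus_smul_xPlus_iff_exists_norm)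
open Summit.HodgeConjecture.HodgeConjecture.Cruxes.H413.F0P3cDyRamTerminalCellOffShellCardTwo (map_sub_div_eq map_sub_mul_eq)
open Summit.HodgeConjecture.HodgeConjecture.Cruxes.H413.F0P3cDyRamRowCleanCellBit (cellDiff_eq_sign_mul_of_clean)
open Summit.HodgeConjecture.HodgeConjecture.Cruxes.H413.F0P3cDyRamRowCleanCells (exists_row_fixed_unit)
open Summit.HodgeConjecture.HodgeConjecture.Cruxes.H413.F0P3cDyRamRowPureCellOfBit (cellDiff_eq_sign_mul_of_bit)
open Summit.HodgeConjecture.HodgeConjecture.Cruxes.H413.F0P3cDyRamDiagonalCellPopRead (isNorm_iff_isNorm_mul_iff)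
open Literature.NumberTheory.LocalFields.WildQuadraticDatum (exists_fixed_unit_not_norm_v_sub_one_le)

variable {E M : Type} [Field E] [Valued E ℤᵐ⁰] [Field M] [Valued M ℤᵐ⁰] {ρ Θ : M →+* M} {α : M}

/-! ## §1 The bit of one glued vertex over the special cell (`q = 2`): the OPPOSITE of the row's bit -/

/-- **THE BIT OF A SPECIAL-CELL VERTEX (`q = 2`).**  ★ p862848 §3's frame (block `(H₂, h_W)`, line model `(M, jE, ρ, Θ, α; φ, lam, h)`, a glued vertex `L` with tube `b` over
`(B₂, w₀, g₀)` presented by `Λ = φ(B₂) = x₀·𝒪_j`, `φ w₀ = Y⁻¹x₀`, `Y ∈ 𝒪_j` of level `b`), the lane-B tokens `|α − ρα| = 1`, `|jE a| = |a|`, the depths `|lam − jE u₀₀| = exp(−m)`,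
`|μ − ρμ| = exp(−jl)` on the ROW `2b = m`, `d` even, the ROW's clean `M`-letter `|μ + jE(fE·t₊·(ϖσϖ)^b)| ≤ |jEϖ|^{2b+m*}` for a `σ`-fixed unit `fE`; cell ABOVE the diagonal AT THE
FLIP DIGIT: `b < j`, `jl = j + b + 2(d − 1) + d % 2`, `d ≤ b`; `|2| < 1`, `#𝓀[E] = 2`.  THEN the `ϖ^{m*}`-value set of `Γ − 1` on `L` equals that of `X₊` IFF `fE·h_W` is NOT a norm:
★ p862848 §3 reads the letter as `VS_{m*}((c·fE·h_W·N(ϖ^b g₀1)) • X₊)` for a `σ`-fixed non-norm unit `c` (★ `exists_fixed_unit_not_norm_v_sub_one_le`), ★ `labelPlus_smul_xPlus_iff_exists_norm`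
reads the bit of that class, ★ `isNorm_iff_isNorm_mul_iff` flips it (index two), the unit norm `N(ϖ^b g₀1)` drops. [cite: Rogawski1990, §4.9 Prop. 4.9.1 (b) p. 55] [cite: Serre1979, Ch. V §3 Prop. 5, Cor. 2–3] [cite: Jacobowitz1962, §4] [cite: LabesseLanglands1979, §2 p. 8] -/
theorem valueSet_SVertex_eq_xPlus_iff_not [CompleteSpace E] [Fintype 𝓀[E]] {σ : E →+* E} {ϖ : E} {d t : ℕ} (hD : IsRamifiedQuadraticDatum σ ϖ d t)
    (h2v : Valued.v (2 : E) < 1) (hq : Fintype.card 𝓀[E] = 2) (hd0 : d % 2 = 0)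
    (H₂ : Matrix (Fin 2) (Fin 2) E) {hW : E} (hhW : Valued.v hW = 1) (hhWσ : σ hW = hW)
    (jE : E →+* M) (hjv : ∀ c, Valued.v (jE c) ≤ 1 ↔ Valued.v c ≤ 1) (hjfix : ∀ z, ρ z = z ↔ ∃ c, jE c = z)
    (hρρ : ∀ x, ρ (ρ x) = x) (hvρ : ∀ x, Valued.v (ρ x) = Valued.v x) (hα : ρ α ≠ α) (hα1 : Valued.v α ≤ 1)
    (hint : ∀ z : M, Valued.v z ≤ 1 → Valued.v ((z - ρ z) / (α - ρ α)) ≤ 1)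
    (hΘΘ : ∀ x, Θ (Θ x) = x) (hΘρ : ∀ x, Θ (ρ x) = ρ (Θ x)) (hvΘ : ∀ x, Valued.v (Θ x) = Valued.v x) (hΘj : ∀ c, Θ (jE c) = jE (σ c))
    (hU : Valued.v (α - ρ α) = 1) (hjiso : ∀ a, Valued.v (jE a) = Valued.v a)
    (φ : (Fin 2 → E) →+ M) (hφs : ∀ (c : E) (x : Fin 2 → E), φ (c • x) = jE c * φ x)
    {γ₂ : GL (Fin 2) E} {lam h : M} (hφγ : ∀ x, φ ((γ₂ : Matrix (Fin 2) (Fin 2) E) *ᵥ x) = lam * φ x) (hh : h ≠ 0) (hΘh : Θ h = h)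
    (hform : ∀ x y, jE (pairing σ H₂ x y) = h * Θ (φ x) * φ y + ρ (h * Θ (φ x) * φ y))
    {L : Submodule 𝒪[E] (Fin 3 → E)} {b : ℕ} (hpr : ∀ x ∈ L, Valued.v (x 1) * Valued.v ϖ ^ b ≤ 1)
    (hintL : ∀ y ∈ L, Valued.v (pairing σ (!![H₂ 0 0, 0, H₂ 0 1; 0, hW, 0; H₂ 1 0, 0, H₂ 1 1] : Matrix (Fin 3) (Fin 3) E) y y) ≤ 1)
    {B₂ : Submodule 𝒪[E] (Fin 2 → E)} {w₀ : Fin 2 → E} {g₀ : Fin 3 → E}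
    (hB : B₂.map ((Matrix.toLin' (!![1, 0; 0, 0; 0, 1] : Matrix (Fin 3) (Fin 2) E)).restrictScalars 𝒪[E]) =
      L ⊓ LinearMap.ker ((LinearMap.proj (1 : Fin 3) : (Fin 3 → E) →ₗ[E] E).restrictScalars 𝒪[E]))
    (hg₀ : g₀ ∈ L) (hg₀1 : Valued.v (g₀ 1) * Valued.v ϖ ^ b = 1) (hprg : g₀ - Pi.single 1 (g₀ 1) = ![w₀ 0, 0, w₀ 1])
    (u : GL (Fin 1) E) (hum : Valued.v ((u : Matrix (Fin 1) (Fin 1) E) 0 0 - 1) ≤ Valued.v (ϖ ^ mstarOfRecord d))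
    {j : ℕ} {x₀ : M} (hx₀ : x₀ ≠ 0) {Λ : AddSubgroup M} (hBΛ : B₂.toAddSubgroup.map φ = Λ)
    (hΛx : ∀ x, x ∈ Λ ↔ ∃ ζ, IsOrd ρ α (jE ϖ ^ j) ζ ∧ x = x₀ * ζ) (hw₀Y : φ w₀ = (dualGen ρ Θ α (jE ϖ ^ j) h x₀)⁻¹ * x₀)
    (hYO : IsOrd ρ α (jE ϖ ^ j) (dualGen ρ Θ α (jE ϖ ^ j) h x₀)) (hYv : Valued.v (dualGen ρ Θ α (jE ϖ ^ j) h x₀) = Valued.v (jE ϖ) ^ b)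
    {m jl : ℕ} (hm : Valued.v (lam - jE ((u : Matrix (Fin 1) (Fin 1) E) 0 0)) = exp (-(m : ℤ)))
    (hjl : Valued.v ((lam - jE ((u : Matrix (Fin 1) (Fin 1) E) 0 0)) - ρ (lam - jE ((u : Matrix (Fin 1) (Fin 1) E) 0 0))) = exp (-(jl : ℤ)))
    (hb2 : 2 * b = m) {fE : E} (hσf : σ fE = fE) (hf1 : Valued.v fE = 1)
    (hμf : Valued.v (lam - jE ((u : Matrix (Fin 1) (Fin 1) E) 0 0) + jE (fE * ((ϖ - σ ϖ) * ((ϖ * σ ϖ) ^ ((d - d % 2) / 2))⁻¹) * (ϖ * σ ϖ) ^ b)) ≤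
      Valued.v (jE ϖ) ^ (2 * b + mstarOfRecord d))
    (hdb : d ≤ b) (hbj : b < j) (hjl' : jl = j + b + (2 * (d - 1) + d % 2)) :
    ({z : E | ∃ y ∈ L, Valued.v ((ϖ ^ mstarOfRecord d)⁻¹ * (z - pairing σ (!![H₂ 0 0, 0, H₂ 0 1; 0, hW, 0; H₂ 1 0, 0, H₂ 1 1] : Matrix (Fin 3) (Fin 3) E) y
        ((((endoGL (γ₂, u) : GL (Fin 3) E) : Matrix (Fin 3) (Fin 3) E) - 1) *ᵥ y))) ≤ 1} = valueSetMod σ ϖ (mstarOfRecord d) (xPlus σ ϖ d)) ↔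
      ¬ ∃ z : E, z * σ z = fE * hW := by
  obtain ⟨hσσ, hvσ, hϖ, -, -, -, -⟩ := id hD
  obtain ⟨hϖ0, hϖlt, hjϖ0, hvjϖ0, hvjϖpos, hjϖlt, hjϖle⟩ := uniformizer_letters jE hjv hϖ
  have hπ : Valued.v (jE ϖ) = exp (-1 : ℤ) := by rw [hjiso, hϖ]
  have hπn : ∀ n : ℕ, Valued.v (jE ϖ) ^ n = exp (-(n : ℤ)) := fun n => by
    rw [hπ, ← exp_nsmul, nsmul_eq_mul, mul_neg, mul_one]
  haveI := isAdicComplete_valuedInteger_of_completeSpace (K := E) hϖ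
  set μ : M := lam - jE ((u : Matrix (Fin 1) (Fin 1) E) 0 0) with hμdef
  -- the `jE(E)`-coordinates of `μ`
  obtain ⟨μb, hμb⟩ := (hjfix _).1 (map_sub_div_eq (α := α) hρρ μ)
  obtain ⟨μa, hμa⟩ := (hjfix _).1 (map_sub_mul_eq hρρ hα μ)
  have hμab : μ = jE μa + jE μb * α := by rw [hμa, hμb]; ring
  have hμbv : Valued.v (jE μb) = Valued.v (jE ϖ) ^ jl := by rw [hμb, Valuation.map_div, hjl, hU, div_one, hπn]
  have hm1 : mstarOfRecord d = 2 * d - 1 := by have := hD.2.2.2.2.2.1; simp only [mstarOfRecord]; omega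
  have hmjl : m + 1 ≤ jl := by omega
  have hμbα : Valued.v (jE μb * α) < Valued.v μ := by
    rw [Valuation.map_mul, hμbv, hm, hπn]
    calc exp (-(jl : ℤ)) * Valued.v α ≤ exp (-(jl : ℤ)) * 1 := mul_le_mul_right hα1 _
      _ < exp (-(m : ℤ)) := by rw [mul_one, exp_lt_exp]; omega
  have hμav : Valued.v μa = Valued.v ϖ ^ (2 * b + d % 2) := by
    rw [hd0, add_zero]
    refine v_eq_pow_of_map_eq jE hjv hϖ0 ?_
    rw [show jE μa = μ - jE μb * α by rw [hμab]; ring, Valuation.map_sub_eq_of_lt_left _ hμbα, hm, hπn, hb2]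
  have hμaE : Valued.v (μa + fE * ((ϖ - σ ϖ) * ((ϖ * σ ϖ) ^ ((d - d % 2) / 2))⁻¹) * (ϖ * σ ϖ) ^ b) ≤ Valued.v ϖ ^ (2 * b + mstarOfRecord d) := by
    refine (v_map_le_pow_iff jE hjv hϖ0 _ _).1 ?_
    have e : jE (μa + fE * ((ϖ - σ ϖ) * ((ϖ * σ ϖ) ^ ((d - d % 2) / 2))⁻¹) * (ϖ * σ ϖ) ^ b) =
        (μ + jE (fE * ((ϖ - σ ϖ) * ((ϖ * σ ϖ) ^ ((d - d % 2) / 2))⁻¹) * (ϖ * σ ϖ) ^ b)) - jE μb * α := by rw [map_add, hμab]; ring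
    rw [e]
    refine (Valuation.map_sub _ _ _).trans (max_le hμf ?_)
    rw [Valuation.map_mul, hμbv]
    calc Valued.v (jE ϖ) ^ jl * Valued.v α ≤ Valued.v (jE ϖ) ^ jl * 1 := mul_le_mul_right hα1 _
      _ ≤ Valued.v (jE ϖ) ^ (2 * b + mstarOfRecord d) := by rw [mul_one]; exact pow_le_pow_right_of_le_one' hjϖle (by omega)
  -- a `σ`-fixed NON-norm unit `c` (`|2| < 1`), and ★ p862848 §3: the letter of the vertex is the `c`-twist
  obtain ⟨c, hσc, hcu, -, hcN⟩ := exists_fixed_unit_not_norm_v_sub_one_le hD h2v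
  rw [valueSet_rowVertex_eq_twist_smul_xPlus_of_tokens hD h2v hq H₂ hhWσ hhW jE hjv hjfix hρρ hvρ hα hα1 hint hΘΘ hΘρ hvΘ hΘj φ hφs hφγ hh hΘh hform hpr hintL hB
    hg₀ hg₀1 hprg u hum hx₀ hBΛ hΛx hw₀Y hYO hYv hμab hμav hμbv hσf hf1 hμaE le_rfl hdb hbj hjl' hσc hcu hcN]
  -- ★ the bit of a `σ`-fixed unit multiple of `X₊`, flipped by the non-norm `c` (index two)
  set g : E := ϖ ^ b * g₀ 1 with hg
  have hg1 : Valued.v g = 1 := by rw [hg, Valuation.map_mul, Valuation.map_pow, mul_comm]; exact hg₀1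
  have hgv0 : g ≠ 0 := fun h0 => by rw [h0, Valuation.map_zero] at hg1; exact zero_ne_one hg1
  have hσg0 : σ g ≠ 0 := (map_ne_zero σ).2 hgv0
  have he : σ (fE * hW * (g * σ g)) = fE * hW * (g * σ g) := by rw [map_mul, map_mul, map_mul, hσf, hhWσ, hσσ]; ring
  have he1 : Valued.v (fE * hW * (g * σ g)) = 1 := by
    rw [Valuation.map_mul, Valuation.map_mul, Valuation.map_mul, hf1, hhW, hvσ, hg1]; simp
  have he0 : fE * hW * (g * σ g) ≠ 0 := fun h0 => by rw [h0, Valuation.map_zero] at he1; exact zero_ne_one he1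
  have hc0 : c ≠ 0 := fun h0 => by rw [h0, Valuation.map_zero] at hcu; exact zero_ne_one hcu
  have hce : σ (c * (fE * hW * (g * σ g))) = c * (fE * hW * (g * σ g)) := by rw [map_mul, hσc, he]
  have hce1 : Valued.v (c * (fE * hW * (g * σ g))) = 1 := by rw [Valuation.map_mul, hcu, he1, one_mul]
  have key := labelPlus_smul_xPlus_iff_exists_norm hD hce hce1
  rw [LabelPlus] at key
  have hdich := isNorm_iff_isNorm_mul_iff hD hσc he hc0 he0
  have heg : (∃ z : E, z * σ z = fE * hW * (g * σ g)) ↔ ∃ z : E, z * σ z = fE * hW := by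
    constructor
    · rintro ⟨z, hz⟩
      refine ⟨z / g, ?_⟩
      rw [map_div₀, div_mul_div_comm, hz]; field_simp
    · rintro ⟨z, hz⟩
      exact ⟨z * g, by rw [map_mul, show z * g * (σ z * σ g) = z * σ z * (g * σ g) by ring, hz]⟩
  refine key.trans ⟨fun hcg hfh => hcN (hdich.2 ⟨fun _ => heg.2 hfh, fun _ => hcg⟩), fun hnf => ?_⟩
  by_contra hncg
  exact hcN (hdich.2 ⟨fun hcg => absurd hcg hncg, fun hg' => absurd (heg.1 hg') hnf⟩)

/-! ## §2 (ROW-REL-S2d) at `d = 2`, modulo the per-vertex socket ‹SDIG› -/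

/-- **(ROW-REL-S2d) AT `d = 2` MODULO ‹SDIG›.**  On the row `2b = m` at `d = 2` (so `4 ≤ m` by the fence `3d ≤ m + 2`), `jl = m + 2d` (δ = 2d), the special cell `j = b + (2d − 2)`
satisfies `n(b,b) * (X(j,b)) = -(n(j,b) * (X(b,b)))` (‹S2D.letter.v1› lines 45–82 VERBATIM) PROVIDED the socket ‹SDIG›: for every `σ`-fixed unit `fE` carrying the row's clean letter
`|μ + jE(fE·t₊·(ϖσϖ)^b)| ≤ |jEϖ|^{2b+m*}`, every glued vertex over every member of the cell has `VS_{m*} = valueSetMod σ ϖ m* X₊ ↔ fE·h_W ∉ N(E^×)` (§3 at `q = 2`; the `q ≥ 4`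
digit-line content otherwise).  D side: ★ p863209's MASTER at `j = b` with ★ `exists_row_fixed_unit`; S side: ★ p863357's FOLD at `β := ¬ (∃ z, z·σz = fE·h_W)`.  Binders ⊂ ‹OFF.letter.v1›
+ row∕gate letters VERBATIM as in ★ p863357 §2; ‹S2D›'s `¬ ∃ iso` is not consumed here. [cite: Kottwitz1986BaseChangeUnits, §1 pp. 240–241] [cite: Rogawski1990, §4.9 Prop. 4.9.1 (b) p. 55]
[cite: Serre1979, Ch. V §3 Cor. 3] -/
theorem n_diag_mul_cellDiff_S_eq_neg_of_sdig
    [CompleteSpace E] [IsDiscreteValuationRing 𝒪[E]]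
    (σ : E →+* E) (ϖ : E) (d tE : ℕ) (hD : IsRamifiedQuadraticDatum σ ϖ d tE)
    (jE : E →+* M) (ρ Θ : M →+* M) (α lam : M)
    (hρρ : ∀ z, ρ (ρ z) = z) (hvρ : ∀ z, Valued.v (ρ z) = Valued.v z)
    (hjv : ∀ a, Valued.v (jE a) ≤ 1 ↔ Valued.v a ≤ 1) (hjfix : ∀ z : M, ρ z = z ↔ ∃ a, jE a = z) (hΘj : ∀ a, Θ (jE a) = jE (σ a))
    (hΘΘ : ∀ z, Θ (Θ z) = z) (hΘρ : ∀ z, Θ (ρ z) = ρ (Θ z)) (hvΘ : ∀ z, Valued.v (Θ z) = Valued.v z)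
    (hα : ρ α ≠ α) (hα1 : Valued.v α ≤ 1) (hint : ∀ z : M, Valued.v z ≤ 1 → Valued.v ((z - ρ z) / (α - ρ α)) ≤ 1)
    (hvlam : Valued.v lam = 1) (hU : Valued.v (α - ρ α) = 1) (hjiso : ∀ a, Valued.v (jE a) = Valued.v a)
    (hjpow : ∀ (t : E) (n : ℤ), Valued.v (jE t) = Valued.v (jE ϖ) ^ n ↔ Valued.v t = Valued.v ϖ ^ n)
    (hϖmax : ∀ t : M, ρ t = t → Valued.v t < 1 → Valued.v t ≤ Valued.v (jE ϖ))
    (γ₂ : GL (Fin 2) E) (u : GL (Fin 1) E) (m jl : ℕ) (hm : Valued.v (lam - jE ((u : Matrix (Fin 1) (Fin 1) E) 0 0)) = WithZero.exp (-(m : ℤ)))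
    (hjl : Valued.v ((lam - jE ((u : Matrix (Fin 1) (Fin 1) E) 0 0)) - ρ (lam - jE ((u : Matrix (Fin 1) (Fin 1) E) 0 0))) = WithZero.exp (-(jl : ℤ)))
    (hum : Valued.v (((u : Matrix (Fin 1) (Fin 1) E) 0 0) - 1) ≤ Valued.v (ϖ ^ mstarOfRecord d))
    (H₂ : Matrix (Fin 2) (Fin 2) E) (hW : E) (hH₂ : IsUnit H₂.det) (hH₂σ : (H₂.map σ)ᵀ = H₂) (hhW : Valued.v hW = 1) (hhWσ : σ hW = hW)
    (φ : (Fin 2 → E) →+ M) (h : M) (hφs : ∀ (c : E) (x : Fin 2 → E), φ (c • x) = jE c * φ x) (hφi : Function.Injective φ) (hφo : Function.Surjective φ)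
    (hφγ : ∀ x, φ ((γ₂ : Matrix (Fin 2) (Fin 2) E).mulVec x) = lam * φ x)
    (hform : ∀ x y, jE (pairing σ H₂ x y) = h * Θ (φ x) * φ y + ρ (h * Θ (φ x) * φ y)) (hΘh : Θ h = h) (hh : h ≠ 0)
    (f : ℕ → ℕ → AddSubgroup M → ℕ)
    (hf : ∀ (b j : ℕ) (Λ : AddSubgroup M) (x₀ : M) (r : E), 1 ≤ b → x₀ ≠ 0 → (∀ x, x ∈ Λ ↔ ∃ z, IsOrd ρ α (jE ϖ ^ j) z ∧ x = x₀ * z) →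
      IsOrd ρ α (jE ϖ ^ j) (dualGen ρ Θ α (jE ϖ ^ j) h x₀) → ¬ IsOrd ρ α (jE ϖ ^ j) (dualGen ρ Θ α (jE ϖ ^ j) h x₀ / jE ϖ) → Valued.v (dualGen ρ Θ α (jE ϖ ^ j) h x₀) = Valued.v (jE ϖ) ^ b →
      (∀ b', (∀ x ∈ Λ, Valued.v (h * Θ x * b' + ρ (h * Θ x * b')) ≤ 1) → (lam - jE ((u : Matrix (Fin 1) (Fin 1) E) 0 0)) * b' ∈ Λ) → IsOrd ρ α (jE ϖ ^ j) lam →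
      jE r = glueUnit ρ Θ α (jE ϖ ^ j) h (jE ϖ) (jE hW) x₀ b →
      f b j Λ = Nat.card {x : 𝒪[E] ⧸ 𝓂[E] ^ (2 * b) // ∃ u' : 𝒪[E], Ideal.Quotient.mk (𝓂[E] ^ (2 * b)) u' = x ∧ Valued.v ((u' : E) * σ u' - r) ≤ Valued.v (ϖ ^ (2 * b))})
    (b : ℕ) (hb2 : 2 * b = m) (hd0 : d % 2 = 0) (hmd : 3 * d ≤ m + 2)
    (hΘlam : Θ lam * lam = 1) (P₁ : GL (Fin 3) E)
    (hA : formCongr σ P₁ ((StdForm.antidiagonal 3).over E) = (!![H₂ 0 0, 0, H₂ 0 1; 0, hW, 0; H₂ 1 0, 0, H₂ 1 1] : Matrix (Fin 3) (Fin 3) E))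
    (hΓ : P₁ * endoGL (γ₂, u) * P₁⁻¹ ∈ unitaryGroupOfForm σ ((StdForm.antidiagonal 3).over E))
    (hd2 : d = 2) (hjl4 : jl = m + 2 * d) (j : ℕ) (hj : b + (2 * d - 2) = j)
    (hsdig : ∀ fE : E, σ fE = fE → Valued.v fE = 1 →
      Valued.v (lam - jE ((u : Matrix (Fin 1) (Fin 1) E) 0 0) + jE (fE * ((ϖ - σ ϖ) * ((ϖ * σ ϖ) ^ ((d - d % 2) / 2))⁻¹) * (ϖ * σ ϖ) ^ b)) ≤
        Valued.v (jE ϖ) ^ (2 * b + mstarOfRecord d) →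
      ∀ Λ ∈ levelSetDep ρ Θ α (jE ϖ) h j b (lam - jE ((u : Matrix (Fin 1) (Fin 1) E) 0 0)), ∀ (B : Submodule 𝒪[E] (Fin 2 → E)) (L₃ : Submodule 𝒪[E] (Fin 3 → E)),
      B.toAddSubgroup.map φ = Λ → IsSelfDualLattice σ ϖ (!![H₂ 0 0, 0, H₂ 0 1; 0, hW, 0; H₂ 1 0, 0, H₂ 1 1] : Matrix (Fin 3) (Fin 3) E) L₃ →
      L₃ ⊓ LinearMap.ker ((LinearMap.proj (1 : Fin 3) : (Fin 3 → E) →ₗ[E] E).restrictScalars 𝒪[E]) =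
        B.map ((Matrix.toLin' (!![1, 0; 0, 0; 0, 1] : Matrix (Fin 3) (Fin 2) E)).restrictScalars 𝒪[E]) →
      (∀ c : E, (Pi.single 1 c : Fin 3 → E) ∈ L₃ ↔ Valued.v c ≤ Valued.v ϖ ^ b) →
      ({z : E | ∃ y ∈ L₃, Valued.v ((ϖ ^ mstarOfRecord d)⁻¹ * (z - pairing σ (!![H₂ 0 0, 0, H₂ 0 1; 0, hW, 0; H₂ 1 0, 0, H₂ 1 1] : Matrix (Fin 3) (Fin 3) E) y
          ((((endoGL (γ₂, u) : GL (Fin 3) E) : Matrix (Fin 3) (Fin 3) E) - 1) *ᵥ y))) ≤ 1} = valueSetMod σ ϖ (mstarOfRecord d) (xPlus σ ϖ d) ↔ ¬ ∃ z : E, z * σ z = fE * hW)) :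
            ((∑ᶠ Λ ∈ levelSetDep ρ Θ α (jE ϖ) h b b (lam - jE ((u : Matrix (Fin 1) (Fin 1) E) 0 0)), f b b Λ : ℕ) : ℤ) *
            (((∑ᶠ Λ ∈ levelSetDep ρ Θ α (jE ϖ) h j b (lam - jE ((u : Matrix (Fin 1) (Fin 1) E) 0 0)) ∩
                      {Λ | ∃ B : Submodule 𝒪[E] (Fin 2 → E), B.toAddSubgroup.map φ = Λ ∧
                        ∃ L₃ : Submodule 𝒪[E] (Fin 3 → E), IsSelfDualLattice σ ϖ (!![H₂ 0 0, 0, H₂ 0 1; 0, hW, 0; H₂ 1 0, 0, H₂ 1 1] : Matrix (Fin 3) (Fin 3) E) L₃ ∧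
                          L₃ ⊓ LinearMap.ker ((LinearMap.proj (1 : Fin 3) : (Fin 3 → E) →ₗ[E] E).restrictScalars 𝒪[E]) =
                            B.map ((Matrix.toLin' (!![1, 0; 0, 0; 0, 1] : Matrix (Fin 3) (Fin 2) E)).restrictScalars 𝒪[E]) ∧
                          (∀ c : E, (Pi.single 1 c : Fin 3 → E) ∈ L₃ ↔ Valued.v c ≤ Valued.v ϖ ^ b) ∧
                          (LatticeNearTransvShell ϖ (d % 2) (mstarOfRecord d) ((((endoGL (γ₂, u) : GL (Fin 3) E) : Matrix (Fin 3) (Fin 3) E) - 1)) L₃ ∧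
                            {z : E | ∃ y ∈ L₃, Valued.v ((ϖ ^ (mstarOfRecord d))⁻¹ * (z - pairing σ (!![H₂ 0 0, 0, H₂ 0 1; 0, hW, 0; H₂ 1 0, 0, H₂ 1 1] : Matrix (Fin 3) (Fin 3) E) y (((((endoGL (γ₂, u) : GL (Fin 3) E) : Matrix (Fin 3) (Fin 3) E) - 1)) *ᵥ y))) ≤ 1} =
                              valueSetMod σ ϖ (mstarOfRecord d) (xPlus σ ϖ d))}, f b j Λ : ℕ) : ℤ) -
                  ((∑ᶠ Λ ∈ levelSetDep ρ Θ α (jE ϖ) h j b (lam - jE ((u : Matrix (Fin 1) (Fin 1) E) 0 0)) ∩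
                      {Λ | ∃ B : Submodule 𝒪[E] (Fin 2 → E), B.toAddSubgroup.map φ = Λ ∧
                        ∃ L₃ : Submodule 𝒪[E] (Fin 3 → E), IsSelfDualLattice σ ϖ (!![H₂ 0 0, 0, H₂ 0 1; 0, hW, 0; H₂ 1 0, 0, H₂ 1 1] : Matrix (Fin 3) (Fin 3) E) L₃ ∧
                          L₃ ⊓ LinearMap.ker ((LinearMap.proj (1 : Fin 3) : (Fin 3 → E) →ₗ[E] E).restrictScalars 𝒪[E]) =
                            B.map ((Matrix.toLin' (!![1, 0; 0, 0; 0, 1] : Matrix (Fin 3) (Fin 2) E)).restrictScalars 𝒪[E]) ∧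
                          (∀ c : E, (Pi.single 1 c : Fin 3 → E) ∈ L₃ ↔ Valued.v c ≤ Valued.v ϖ ^ b) ∧
                          (LatticeNearTransvShell ϖ (d % 2) (mcOfRecord d) ((((endoGL (γ₂, u) : GL (Fin 3) E) : Matrix (Fin 3) (Fin 3) E) - 1)) L₃ ∧
                            ¬ {z : E | ∃ y ∈ L₃, Valued.v ((ϖ ^ (mstarOfRecord d))⁻¹ * (z - pairing σ (!![H₂ 0 0, 0, H₂ 0 1; 0, hW, 0; H₂ 1 0, 0, H₂ 1 1] : Matrix (Fin 3) (Fin 3) E) y (((((endoGL (γ₂, u) : GL (Fin 3) E) : Matrix (Fin 3) (Fin 3) E) - 1)) *ᵥ y))) ≤ 1} =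
                              valueSetMod σ ϖ (mstarOfRecord d) (xPlus σ ϖ d))}, f b j Λ : ℕ) : ℤ)) =
            -(((∑ᶠ Λ ∈ levelSetDep ρ Θ α (jE ϖ) h j b (lam - jE ((u : Matrix (Fin 1) (Fin 1) E) 0 0)), f b j Λ : ℕ) : ℤ) *
            (((∑ᶠ Λ ∈ levelSetDep ρ Θ α (jE ϖ) h b b (lam - jE ((u : Matrix (Fin 1) (Fin 1) E) 0 0)) ∩
                      {Λ | ∃ B : Submodule 𝒪[E] (Fin 2 → E), B.toAddSubgroup.map φ = Λ ∧
                        ∃ L₃ : Submodule 𝒪[E] (Fin 3 → E), IsSelfDualLattice σ ϖ (!![H₂ 0 0, 0, H₂ 0 1; 0, hW, 0; H₂ 1 0, 0, H₂ 1 1] : Matrix (Fin 3) (Fin 3) E) L₃ ∧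
                          L₃ ⊓ LinearMap.ker ((LinearMap.proj (1 : Fin 3) : (Fin 3 → E) →ₗ[E] E).restrictScalars 𝒪[E]) =
                            B.map ((Matrix.toLin' (!![1, 0; 0, 0; 0, 1] : Matrix (Fin 3) (Fin 2) E)).restrictScalars 𝒪[E]) ∧
                          (∀ c : E, (Pi.single 1 c : Fin 3 → E) ∈ L₃ ↔ Valued.v c ≤ Valued.v ϖ ^ b) ∧
                          (LatticeNearTransvShell ϖ (d % 2) (mstarOfRecord d) ((((endoGL (γ₂, u) : GL (Fin 3) E) : Matrix (Fin 3) (Fin 3) E) - 1)) L₃ ∧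
                            {z : E | ∃ y ∈ L₃, Valued.v ((ϖ ^ (mstarOfRecord d))⁻¹ * (z - pairing σ (!![H₂ 0 0, 0, H₂ 0 1; 0, hW, 0; H₂ 1 0, 0, H₂ 1 1] : Matrix (Fin 3) (Fin 3) E) y (((((endoGL (γ₂, u) : GL (Fin 3) E) : Matrix (Fin 3) (Fin 3) E) - 1)) *ᵥ y))) ≤ 1} =
                              valueSetMod σ ϖ (mstarOfRecord d) (xPlus σ ϖ d))}, f b b Λ : ℕ) : ℤ) -
                  ((∑ᶠ Λ ∈ levelSetDep ρ Θ α (jE ϖ) h b b (lam - jE ((u : Matrix (Fin 1) (Fin 1) E) 0 0)) ∩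
                      {Λ | ∃ B : Submodule 𝒪[E] (Fin 2 → E), B.toAddSubgroup.map φ = Λ ∧
                        ∃ L₃ : Submodule 𝒪[E] (Fin 3 → E), IsSelfDualLattice σ ϖ (!![H₂ 0 0, 0, H₂ 0 1; 0, hW, 0; H₂ 1 0, 0, H₂ 1 1] : Matrix (Fin 3) (Fin 3) E) L₃ ∧
                          L₃ ⊓ LinearMap.ker ((LinearMap.proj (1 : Fin 3) : (Fin 3 → E) →ₗ[E] E).restrictScalars 𝒪[E]) =
                            B.map ((Matrix.toLin' (!![1, 0; 0, 0; 0, 1] : Matrix (Fin 3) (Fin 2) E)).restrictScalars 𝒪[E]) ∧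
                          (∀ c : E, (Pi.single 1 c : Fin 3 → E) ∈ L₃ ↔ Valued.v c ≤ Valued.v ϖ ^ b) ∧
                          (LatticeNearTransvShell ϖ (d % 2) (mcOfRecord d) ((((endoGL (γ₂, u) : GL (Fin 3) E) : Matrix (Fin 3) (Fin 3) E) - 1)) L₃ ∧
                            ¬ {z : E | ∃ y ∈ L₃, Valued.v ((ϖ ^ (mstarOfRecord d))⁻¹ * (z - pairing σ (!![H₂ 0 0, 0, H₂ 0 1; 0, hW, 0; H₂ 1 0, 0, H₂ 1 1] : Matrix (Fin 3) (Fin 3) E) y (((((endoGL (γ₂, u) : GL (Fin 3) E) : Matrix (Fin 3) (Fin 3) E) - 1)) *ᵥ y))) ≤ 1} =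
                              valueSetMod σ ϖ (mstarOfRecord d) (xPlus σ ϖ d))}, f b b Λ : ℕ) : ℤ))) := by
  have hgap : 3 * d + m ≤ jl + 2 := by omega
  obtain ⟨fE, hσf, hf1, hμf⟩ := exists_row_fixed_unit σ ϖ d tE hD jE ρ Θ α lam hρρ hjv hjfix hΘj hvΘ hα hα1 hint hvlam hU hjiso γ₂ u m jl hm hjl hum H₂ hW hhW
    b hb2 hd0 hmd hΘlam P₁ hA hΓ hgap
  have Hb := cellDiff_eq_sign_mul_of_clean σ ϖ d tE hD jE ρ Θ α lam hρρ hvρ hjv hjfix hΘj hΘΘ hΘρ hvΘ hα hα1 hint hvlam hU hjiso hjpow hϖmax γ₂ u m jl hm hjl hum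
    H₂ hW hH₂ hH₂σ hhW hhWσ φ h hφs hφi hφo hφγ hform hΘh hh f hf b hb2 hd0 hmd hσf hf1 hμf (j := b) le_rfl (by simp only [mstarOfRecord]; omega)
  have Hj := cellDiff_eq_sign_mul_of_bit σ ϖ d tE hD jE ρ Θ α lam hρρ hvρ hjv hjfix hΘj hΘΘ hΘρ hvΘ hα hα1 hint hvlam hU hjiso hjpow hϖmax γ₂ u m jl hm hjl hum
    H₂ hW hH₂ hH₂σ hhW hhWσ φ h hφs hφi hφo hφγ hform hΘh hh f hf b hb2 hd0 hmd (j := j) (by omega) (by omega) (¬ ∃ z : E, z * σ z = fE * hW)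
    (hsdig fE hσf hf1 hμf)
  have key : ∀ (P : Prop) (i₁ : Decidable P) (i₂ : Decidable ¬P) {Xj Xb Nj Nb : ℤ},
      Xj = (@ite ℤ (¬P) i₂ 1 (-1)) * Nj → Xb = (@ite ℤ P i₁ 1 (-1)) * Nb → Nb * Xj = -(Nj * Xb) := by
    intro P i₁ i₂ Xj Xb Nj Nb h1 h2
    rw [h1, h2]
    by_cases hP : P
    · rw [if_pos hP, if_neg (not_not_intro hP)]; ring
    · rw [if_neg hP, if_pos hP]; ring
  exact key _ _ _ Hj Hb

/-! ## §3 The socket ‹SDIG› at `q = 2`, and (ROW-REL-S2d) at `d = 2`, `q = 2` unconditionally -/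

/-- **‹SDIG› AT `q = 2`.**  On the row `2b = m`, `d` even, for a cell at the flip digit (`d ≤ b < j`, `jl = j + b + 2(d − 1) + d % 2`): for every `σ`-fixed unit `fE` with the row's clean
letter, every glued vertex `L₃` over every member `Λ` of the cell has `VS_{m*}(L₃) = valueSetMod σ ϖ m* X₊ ↔ fE·h_W ∉ N(E^×)` — ★ p862869 `exists_presentation_of_mem_levelSetDep` presents the
vertex, §1 reads its bit; `|2| < 1` from ‹OFF›'s `¬ IsUnit 2`, `#𝓀[E] = 2` as `Nat.card`.  Binders ⊂ the MASTER's block. [cite: Jacobowitz1962, §4] [cite: Rogawski1990, §4.9 Prop. 4.9.1 (b) p. 55]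
[cite: Serre1979, Ch. V §3 Prop. 5, Cor. 2–3] -/
theorem sdig_of_card_two
    [CompleteSpace E] [IsDiscreteValuationRing 𝒪[E]] [Finite 𝓀[E]]
    (σ : E →+* E) (ϖ : E) (d tE : ℕ) (hD : IsRamifiedQuadraticDatum σ ϖ d tE) (h2 : ¬ IsUnit (2 : 𝒪[E])) (hqE : Nat.card 𝓀[E] = 2)
    (jE : E →+* M) (ρ Θ : M →+* M) (α lam : M)
    (hρρ : ∀ z, ρ (ρ z) = z) (hvρ : ∀ z, Valued.v (ρ z) = Valued.v z)
    (hjv : ∀ a, Valued.v (jE a) ≤ 1 ↔ Valued.v a ≤ 1) (hjfix : ∀ z : M, ρ z = z ↔ ∃ a, jE a = z) (hΘj : ∀ a, Θ (jE a) = jE (σ a))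
    (hΘΘ : ∀ z, Θ (Θ z) = z) (hΘρ : ∀ z, Θ (ρ z) = ρ (Θ z)) (hvΘ : ∀ z, Valued.v (Θ z) = Valued.v z)
    (hα : ρ α ≠ α) (hα1 : Valued.v α ≤ 1) (hint : ∀ z : M, Valued.v z ≤ 1 → Valued.v ((z - ρ z) / (α - ρ α)) ≤ 1)
    (hvlam : Valued.v lam = 1) (hU : Valued.v (α - ρ α) = 1) (hjiso : ∀ a, Valued.v (jE a) = Valued.v a)
    (hjpow : ∀ (t : E) (n : ℤ), Valued.v (jE t) = Valued.v (jE ϖ) ^ n ↔ Valued.v t = Valued.v ϖ ^ n)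
    (hϖmax : ∀ t : M, ρ t = t → Valued.v t < 1 → Valued.v t ≤ Valued.v (jE ϖ))
    (γ₂ : GL (Fin 2) E) (u : GL (Fin 1) E) (m jl : ℕ) (hm : Valued.v (lam - jE ((u : Matrix (Fin 1) (Fin 1) E) 0 0)) = WithZero.exp (-(m : ℤ)))
    (hjl : Valued.v ((lam - jE ((u : Matrix (Fin 1) (Fin 1) E) 0 0)) - ρ (lam - jE ((u : Matrix (Fin 1) (Fin 1) E) 0 0))) = WithZero.exp (-(jl : ℤ)))
    (hum : Valued.v (((u : Matrix (Fin 1) (Fin 1) E) 0 0) - 1) ≤ Valued.v (ϖ ^ mstarOfRecord d))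
    (H₂ : Matrix (Fin 2) (Fin 2) E) (hW : E) (hH₂ : IsUnit H₂.det) (hH₂σ : (H₂.map σ)ᵀ = H₂) (hhW : Valued.v hW = 1) (hhWσ : σ hW = hW)
    (φ : (Fin 2 → E) →+ M) (h : M) (hφs : ∀ (c : E) (x : Fin 2 → E), φ (c • x) = jE c * φ x) (hφi : Function.Injective φ) (hφo : Function.Surjective φ)
    (hφγ : ∀ x, φ ((γ₂ : Matrix (Fin 2) (Fin 2) E).mulVec x) = lam * φ x)
    (hform : ∀ x y, jE (pairing σ H₂ x y) = h * Θ (φ x) * φ y + ρ (h * Θ (φ x) * φ y)) (hΘh : Θ h = h) (hh : h ≠ 0)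
    (b : ℕ) (hb2 : 2 * b = m) (hd0 : d % 2 = 0) {j : ℕ} (hdb : d ≤ b) (hbj : b < j) (hflip : jl = j + b + (2 * (d - 1) + d % 2)) :
    ∀ fE : E, σ fE = fE → Valued.v fE = 1 →
      Valued.v (lam - jE ((u : Matrix (Fin 1) (Fin 1) E) 0 0) + jE (fE * ((ϖ - σ ϖ) * ((ϖ * σ ϖ) ^ ((d - d % 2) / 2))⁻¹) * (ϖ * σ ϖ) ^ b)) ≤
        Valued.v (jE ϖ) ^ (2 * b + mstarOfRecord d) →
      ∀ Λ ∈ levelSetDep ρ Θ α (jE ϖ) h j b (lam - jE ((u : Matrix (Fin 1) (Fin 1) E) 0 0)), ∀ (B : Submodule 𝒪[E] (Fin 2 → E)) (L₃ : Submodule 𝒪[E] (Fin 3 → E)),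
      B.toAddSubgroup.map φ = Λ → IsSelfDualLattice σ ϖ (!![H₂ 0 0, 0, H₂ 0 1; 0, hW, 0; H₂ 1 0, 0, H₂ 1 1] : Matrix (Fin 3) (Fin 3) E) L₃ →
      L₃ ⊓ LinearMap.ker ((LinearMap.proj (1 : Fin 3) : (Fin 3 → E) →ₗ[E] E).restrictScalars 𝒪[E]) =
        B.map ((Matrix.toLin' (!![1, 0; 0, 0; 0, 1] : Matrix (Fin 3) (Fin 2) E)).restrictScalars 𝒪[E]) →
      (∀ c : E, (Pi.single 1 c : Fin 3 → E) ∈ L₃ ↔ Valued.v c ≤ Valued.v ϖ ^ b) →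
      ({z : E | ∃ y ∈ L₃, Valued.v ((ϖ ^ mstarOfRecord d)⁻¹ * (z - pairing σ (!![H₂ 0 0, 0, H₂ 0 1; 0, hW, 0; H₂ 1 0, 0, H₂ 1 1] : Matrix (Fin 3) (Fin 3) E) y
          ((((endoGL (γ₂, u) : GL (Fin 3) E) : Matrix (Fin 3) (Fin 3) E) - 1) *ᵥ y))) ≤ 1} = valueSetMod σ ϖ (mstarOfRecord d) (xPlus σ ϖ d) ↔ ¬ ∃ z : E, z * σ z = fE * hW) := by
  intro fE hσf hf1 hμf Λ hΛ B L₃ hBΛ hL hLB htube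
  obtain ⟨hσσ, hvσ, hϖ, -, -, hd1, -⟩ := id hD
  haveI : Fintype 𝓀[E] := Fintype.ofFinite _
  have hq : Fintype.card 𝓀[E] = 2 := by rw [Fintype.card_eq_nat_card]; exact hqE
  have h2v : Valued.v (2 : E) < 1 := by
    have h2' := Valuation.Integer.not_isUnit_iff_valuation_lt_one.mp h2
    exact_mod_cast h2'
  have hπ : Valued.v (jE ϖ) = exp (-1 : ℤ) := by rw [hjiso, hϖ]
  have hπn : ∀ n : ℕ, Valued.v (jE ϖ) ^ n = exp (-(n : ℤ)) := fun n => by rw [hπ, ← exp_nsmul, nsmul_eq_mul, mul_neg, mul_one]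
  have hb1 : 1 ≤ b := le_trans hd1 hdb
  have hlamj : IsOrd ρ α (jE ϖ ^ j) lam := by
    refine ⟨hvlam.le, ?_⟩
    have e : lam - ρ lam = (lam - jE ((u : Matrix (Fin 1) (Fin 1) E) 0 0)) - ρ (lam - jE ((u : Matrix (Fin 1) (Fin 1) E) 0 0)) := by
      rw [map_sub, (hjfix _).2 ⟨_, rfl⟩]; ring
    rw [e, hjl, Valuation.map_mul, Valuation.map_pow, hU, mul_one, hπn, exp_le_exp]; omega
  obtain ⟨x₀, w₀, g₀, hx₀, hΛx, hyO, -, hylev, hw₀Y, hpr, hg₀, hg₀1, hprg⟩ :=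
    exists_presentation_of_mem_levelSetDep σ hσσ hvσ hϖ hH₂ hH₂σ hhW jE hρρ hvρ hα hα1 hint hΘΘ hΘρ hvΘ hjv hjfix hjpow hϖmax φ hφs hφi hφo hφγ hvlam hΘh hh hform
      ((u : Matrix (Fin 1) (Fin 1) E) 0 0) hb1 hlamj hΛ hBΛ hL hLB htube
  have hintL : ∀ y ∈ L₃, Valued.v (pairing σ (!![H₂ 0 0, 0, H₂ 0 1; 0, hW, 0; H₂ 1 0, 0, H₂ 1 1] : Matrix (Fin 3) (Fin 3) E) y y) ≤ 1 :=
    fun y hy => (mem_dualLatt σ _ L₃ y).1 (le_dualLatt_of_isVertexLattice hvσ hL hy) y hy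
  exact valueSet_SVertex_eq_xPlus_iff_not hD h2v hq hd0 H₂ hhW hhWσ jE hjv hjfix hρρ hvρ hα hα1 hint hΘΘ hΘρ hvΘ hΘj hU hjiso φ hφs hφγ hh hΘh hform hpr hintL
    hLB.symm hg₀ hg₀1 hprg u hum hx₀ hBΛ hΛx hw₀Y hyO hylev hm hjl hb2 hσf hf1 hμf hdb hbj hflip

/-- **(ROW-REL-S2d) AT `d = 2`, `q = 2` — UNCONDITIONAL** (‹S2D.letter.v1›'s shape at `#𝓀[E] = 2`): `jl = m + 2*d → b + (2*d − 2) = j → n(b,b) * (X(j,b)) = -(n(j,b) * (X(b,b)))`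
— §2 with the socket paid by §3 (`d ≤ b` from `4 ≤ m = 2b`; the flip digit `jl = j + b + 2(d − 1) + d % 2` at `d = 2`); at `q ≥ 4` the same conclusion is §2 modulo ‹SDIG›.
[cite: Kottwitz1986BaseChangeUnits, §1 pp. 240–241] [cite: Rogawski1990, §4.9 Prop. 4.9.1 (b) p. 55] -/
theorem n_diag_mul_cellDiff_S_eq_neg_of_card_two
    [CompleteSpace E] [IsDiscreteValuationRing 𝒪[E]] [Finite 𝓀[E]]
    (σ : E →+* E) (ϖ : E) (d tE : ℕ) (hD : IsRamifiedQuadraticDatum σ ϖ d tE) (h2 : ¬ IsUnit (2 : 𝒪[E])) (hqE : Nat.card 𝓀[E] = 2)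
    (jE : E →+* M) (ρ Θ : M →+* M) (α lam : M)
    (hρρ : ∀ z, ρ (ρ z) = z) (hvρ : ∀ z, Valued.v (ρ z) = Valued.v z)
    (hjv : ∀ a, Valued.v (jE a) ≤ 1 ↔ Valued.v a ≤ 1) (hjfix : ∀ z : M, ρ z = z ↔ ∃ a, jE a = z) (hΘj : ∀ a, Θ (jE a) = jE (σ a))
    (hΘΘ : ∀ z, Θ (Θ z) = z) (hΘρ : ∀ z, Θ (ρ z) = ρ (Θ z)) (hvΘ : ∀ z, Valued.v (Θ z) = Valued.v z)
    (hα : ρ α ≠ α) (hα1 : Valued.v α ≤ 1) (hint : ∀ z : M, Valued.v z ≤ 1 → Valued.v ((z - ρ z) / (α - ρ α)) ≤ 1)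
    (hvlam : Valued.v lam = 1) (hU : Valued.v (α - ρ α) = 1) (hjiso : ∀ a, Valued.v (jE a) = Valued.v a)
    (hjpow : ∀ (t : E) (n : ℤ), Valued.v (jE t) = Valued.v (jE ϖ) ^ n ↔ Valued.v t = Valued.v ϖ ^ n)
    (hϖmax : ∀ t : M, ρ t = t → Valued.v t < 1 → Valued.v t ≤ Valued.v (jE ϖ))
    (γ₂ : GL (Fin 2) E) (u : GL (Fin 1) E) (m jl : ℕ) (hm : Valued.v (lam - jE ((u : Matrix (Fin 1) (Fin 1) E) 0 0)) = WithZero.exp (-(m : ℤ)))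
    (hjl : Valued.v ((lam - jE ((u : Matrix (Fin 1) (Fin 1) E) 0 0)) - ρ (lam - jE ((u : Matrix (Fin 1) (Fin 1) E) 0 0))) = WithZero.exp (-(jl : ℤ)))
    (hum : Valued.v (((u : Matrix (Fin 1) (Fin 1) E) 0 0) - 1) ≤ Valued.v (ϖ ^ mstarOfRecord d))
    (H₂ : Matrix (Fin 2) (Fin 2) E) (hW : E) (hH₂ : IsUnit H₂.det) (hH₂σ : (H₂.map σ)ᵀ = H₂) (hhW : Valued.v hW = 1) (hhWσ : σ hW = hW)
    (φ : (Fin 2 → E) →+ M) (h : M) (hφs : ∀ (c : E) (x : Fin 2 → E), φ (c • x) = jE c * φ x) (hφi : Function.Injective φ) (hφo : Function.Surjective φ)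
    (hφγ : ∀ x, φ ((γ₂ : Matrix (Fin 2) (Fin 2) E).mulVec x) = lam * φ x)
    (hform : ∀ x y, jE (pairing σ H₂ x y) = h * Θ (φ x) * φ y + ρ (h * Θ (φ x) * φ y)) (hΘh : Θ h = h) (hh : h ≠ 0)
    (f : ℕ → ℕ → AddSubgroup M → ℕ)
    (hf : ∀ (b j : ℕ) (Λ : AddSubgroup M) (x₀ : M) (r : E), 1 ≤ b → x₀ ≠ 0 → (∀ x, x ∈ Λ ↔ ∃ z, IsOrd ρ α (jE ϖ ^ j) z ∧ x = x₀ * z) →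
      IsOrd ρ α (jE ϖ ^ j) (dualGen ρ Θ α (jE ϖ ^ j) h x₀) → ¬ IsOrd ρ α (jE ϖ ^ j) (dualGen ρ Θ α (jE ϖ ^ j) h x₀ / jE ϖ) → Valued.v (dualGen ρ Θ α (jE ϖ ^ j) h x₀) = Valued.v (jE ϖ) ^ b →
      (∀ b', (∀ x ∈ Λ, Valued.v (h * Θ x * b' + ρ (h * Θ x * b')) ≤ 1) → (lam - jE ((u : Matrix (Fin 1) (Fin 1) E) 0 0)) * b' ∈ Λ) → IsOrd ρ α (jE ϖ ^ j) lam →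
      jE r = glueUnit ρ Θ α (jE ϖ ^ j) h (jE ϖ) (jE hW) x₀ b →
      f b j Λ = Nat.card {x : 𝒪[E] ⧸ 𝓂[E] ^ (2 * b) // ∃ u' : 𝒪[E], Ideal.Quotient.mk (𝓂[E] ^ (2 * b)) u' = x ∧ Valued.v ((u' : E) * σ u' - r) ≤ Valued.v (ϖ ^ (2 * b))})
    (b : ℕ) (hb2 : 2 * b = m) (hd0 : d % 2 = 0) (hmd : 3 * d ≤ m + 2)
    (hΘlam : Θ lam * lam = 1) (P₁ : GL (Fin 3) E)
    (hA : formCongr σ P₁ ((StdForm.antidiagonal 3).over E) = (!![H₂ 0 0, 0, H₂ 0 1; 0, hW, 0; H₂ 1 0, 0, H₂ 1 1] : Matrix (Fin 3) (Fin 3) E))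
    (hΓ : P₁ * endoGL (γ₂, u) * P₁⁻¹ ∈ unitaryGroupOfForm σ ((StdForm.antidiagonal 3).over E))
    (hd2 : d = 2) (hjl4 : jl = m + 2 * d) (j : ℕ) (hj : b + (2 * d - 2) = j) :
            ((∑ᶠ Λ ∈ levelSetDep ρ Θ α (jE ϖ) h b b (lam - jE ((u : Matrix (Fin 1) (Fin 1) E) 0 0)), f b b Λ : ℕ) : ℤ) *
            (((∑ᶠ Λ ∈ levelSetDep ρ Θ α (jE ϖ) h j b (lam - jE ((u : Matrix (Fin 1) (Fin 1) E) 0 0)) ∩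
                      {Λ | ∃ B : Submodule 𝒪[E] (Fin 2 → E), B.toAddSubgroup.map φ = Λ ∧
                        ∃ L₃ : Submodule 𝒪[E] (Fin 3 → E), IsSelfDualLattice σ ϖ (!![H₂ 0 0, 0, H₂ 0 1; 0, hW, 0; H₂ 1 0, 0, H₂ 1 1] : Matrix (Fin 3) (Fin 3) E) L₃ ∧
                          L₃ ⊓ LinearMap.ker ((LinearMap.proj (1 : Fin 3) : (Fin 3 → E) →ₗ[E] E).restrictScalars 𝒪[E]) =
                            B.map ((Matrix.toLin' (!![1, 0; 0, 0; 0, 1] : Matrix (Fin 3) (Fin 2) E)).restrictScalars 𝒪[E]) ∧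
                          (∀ c : E, (Pi.single 1 c : Fin 3 → E) ∈ L₃ ↔ Valued.v c ≤ Valued.v ϖ ^ b) ∧
                          (LatticeNearTransvShell ϖ (d % 2) (mstarOfRecord d) ((((endoGL (γ₂, u) : GL (Fin 3) E) : Matrix (Fin 3) (Fin 3) E) - 1)) L₃ ∧
                            {z : E | ∃ y ∈ L₃, Valued.v ((ϖ ^ (mstarOfRecord d))⁻¹ * (z - pairing σ (!![H₂ 0 0, 0, H₂ 0 1; 0, hW, 0; H₂ 1 0, 0, H₂ 1 1] : Matrix (Fin 3) (Fin 3) E) y (((((endoGL (γ₂, u) : GL (Fin 3) E) : Matrix (Fin 3) (Fin 3) E) - 1)) *ᵥ y))) ≤ 1} =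
                              valueSetMod σ ϖ (mstarOfRecord d) (xPlus σ ϖ d))}, f b j Λ : ℕ) : ℤ) -
                  ((∑ᶠ Λ ∈ levelSetDep ρ Θ α (jE ϖ) h j b (lam - jE ((u : Matrix (Fin 1) (Fin 1) E) 0 0)) ∩
                      {Λ | ∃ B : Submodule 𝒪[E] (Fin 2 → E), B.toAddSubgroup.map φ = Λ ∧
                        ∃ L₃ : Submodule 𝒪[E] (Fin 3 → E), IsSelfDualLattice σ ϖ (!![H₂ 0 0, 0, H₂ 0 1; 0, hW, 0; H₂ 1 0, 0, H₂ 1 1] : Matrix (Fin 3) (Fin 3) E) L₃ ∧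
                          L₃ ⊓ LinearMap.ker ((LinearMap.proj (1 : Fin 3) : (Fin 3 → E) →ₗ[E] E).restrictScalars 𝒪[E]) =
                            B.map ((Matrix.toLin' (!![1, 0; 0, 0; 0, 1] : Matrix (Fin 3) (Fin 2) E)).restrictScalars 𝒪[E]) ∧
                          (∀ c : E, (Pi.single 1 c : Fin 3 → E) ∈ L₃ ↔ Valued.v c ≤ Valued.v ϖ ^ b) ∧
                          (LatticeNearTransvShell ϖ (d % 2) (mcOfRecord d) ((((endoGL (γ₂, u) : GL (Fin 3) E) : Matrix (Fin 3) (Fin 3) E) - 1)) L₃ ∧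
                            ¬ {z : E | ∃ y ∈ L₃, Valued.v ((ϖ ^ (mstarOfRecord d))⁻¹ * (z - pairing σ (!![H₂ 0 0, 0, H₂ 0 1; 0, hW, 0; H₂ 1 0, 0, H₂ 1 1] : Matrix (Fin 3) (Fin 3) E) y (((((endoGL (γ₂, u) : GL (Fin 3) E) : Matrix (Fin 3) (Fin 3) E) - 1)) *ᵥ y))) ≤ 1} =
                              valueSetMod σ ϖ (mstarOfRecord d) (xPlus σ ϖ d))}, f b j Λ : ℕ) : ℤ)) =
            -(((∑ᶠ Λ ∈ levelSetDep ρ Θ α (jE ϖ) h j b (lam - jE ((u : Matrix (Fin 1) (Fin 1) E) 0 0)), f b j Λ : ℕ) : ℤ) *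
            (((∑ᶠ Λ ∈ levelSetDep ρ Θ α (jE ϖ) h b b (lam - jE ((u : Matrix (Fin 1) (Fin 1) E) 0 0)) ∩
                      {Λ | ∃ B : Submodule 𝒪[E] (Fin 2 → E), B.toAddSubgroup.map φ = Λ ∧
                        ∃ L₃ : Submodule 𝒪[E] (Fin 3 → E), IsSelfDualLattice σ ϖ (!![H₂ 0 0, 0, H₂ 0 1; 0, hW, 0; H₂ 1 0, 0, H₂ 1 1] : Matrix (Fin 3) (Fin 3) E) L₃ ∧
                          L₃ ⊓ LinearMap.ker ((LinearMap.proj (1 : Fin 3) : (Fin 3 → E) →ₗ[E] E).restrictScalars 𝒪[E]) =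
                            B.map ((Matrix.toLin' (!![1, 0; 0, 0; 0, 1] : Matrix (Fin 3) (Fin 2) E)).restrictScalars 𝒪[E]) ∧
                          (∀ c : E, (Pi.single 1 c : Fin 3 → E) ∈ L₃ ↔ Valued.v c ≤ Valued.v ϖ ^ b) ∧
                          (LatticeNearTransvShell ϖ (d % 2) (mstarOfRecord d) ((((endoGL (γ₂, u) : GL (Fin 3) E) : Matrix (Fin 3) (Fin 3) E) - 1)) L₃ ∧
                            {z : E | ∃ y ∈ L₃, Valued.v ((ϖ ^ (mstarOfRecord d))⁻¹ * (z - pairing σ (!![H₂ 0 0, 0, H₂ 0 1; 0, hW, 0; H₂ 1 0, 0, H₂ 1 1] : Matrix (Fin 3) (Fin 3) E) y (((((endoGL (γ₂, u) : GL (Fin 3) E) : Matrix (Fin 3) (Fin 3) E) - 1)) *ᵥ y))) ≤ 1} =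
                              valueSetMod σ ϖ (mstarOfRecord d) (xPlus σ ϖ d))}, f b b Λ : ℕ) : ℤ) -
                  ((∑ᶠ Λ ∈ levelSetDep ρ Θ α (jE ϖ) h b b (lam - jE ((u : Matrix (Fin 1) (Fin 1) E) 0 0)) ∩
                      {Λ | ∃ B : Submodule 𝒪[E] (Fin 2 → E), B.toAddSubgroup.map φ = Λ ∧
                        ∃ L₃ : Submodule 𝒪[E] (Fin 3 → E), IsSelfDualLattice σ ϖ (!![H₂ 0 0, 0, H₂ 0 1; 0, hW, 0; H₂ 1 0, 0, H₂ 1 1] : Matrix (Fin 3) (Fin 3) E) L₃ ∧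
                          L₃ ⊓ LinearMap.ker ((LinearMap.proj (1 : Fin 3) : (Fin 3 → E) →ₗ[E] E).restrictScalars 𝒪[E]) =
                            B.map ((Matrix.toLin' (!![1, 0; 0, 0; 0, 1] : Matrix (Fin 3) (Fin 2) E)).restrictScalars 𝒪[E]) ∧
                          (∀ c : E, (Pi.single 1 c : Fin 3 → E) ∈ L₃ ↔ Valued.v c ≤ Valued.v ϖ ^ b) ∧
                          (LatticeNearTransvShell ϖ (d % 2) (mcOfRecord d) ((((endoGL (γ₂, u) : GL (Fin 3) E) : Matrix (Fin 3) (Fin 3) E) - 1)) L₃ ∧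
                            ¬ {z : E | ∃ y ∈ L₃, Valued.v ((ϖ ^ (mstarOfRecord d))⁻¹ * (z - pairing σ (!![H₂ 0 0, 0, H₂ 0 1; 0, hW, 0; H₂ 1 0, 0, H₂ 1 1] : Matrix (Fin 3) (Fin 3) E) y (((((endoGL (γ₂, u) : GL (Fin 3) E) : Matrix (Fin 3) (Fin 3) E) - 1)) *ᵥ y))) ≤ 1} =
                              valueSetMod σ ϖ (mstarOfRecord d) (xPlus σ ϖ d))}, f b b Λ : ℕ) : ℤ))) :=
  n_diag_mul_cellDiff_S_eq_neg_of_sdig σ ϖ d tE hD jE ρ Θ α lam hρρ hvρ hjv hjfix hΘj hΘΘ hΘρ hvΘ hα hα1 hint hvlam hU hjiso hjpow hϖmax γ₂ u m jl hm hjl hum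
    H₂ hW hH₂ hH₂σ hhW hhWσ φ h hφs hφi hφo hφγ hform hΘh hh f hf b hb2 hd0 hmd hΘlam P₁ hA hΓ hd2 hjl4 j hj
    (sdig_of_card_two σ ϖ d tE hD h2 hqE jE ρ Θ α lam hρρ hvρ hjv hjfix hΘj hΘΘ hΘρ hvΘ hα hα1 hint hvlam hU hjiso hjpow hϖmax γ₂ u m jl hm hjl hum
      H₂ hW hH₂ hH₂σ hhW hhWσ φ h hφs hφi hφo hφγ hform hΘh hh b hb2 hd0 (by omega) (by omega) (by omega))

end Summit.HodgeConjecture.HodgeConjecture.Cruxes.H413.F0P3cDyRamRowSCellTwist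

end
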